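import Literature.NumberTheory.Sieve.SmoothZetaDecayNearAxis
import Literature.NumberTheory.Sieve.SmoothSaddlePointPhiHigher
import Mathlib.Analysis.SpecialFunctions.Complex.LogBounds
import Mathlib.Analysis.SpecialFunctions.ImproperIntegrals
import HarnessLib

/-!
# Lemma 8 of Hildebrand–Tenenbaum at exact strength: `|ζ(s, y)| ≤ ζ(σ, y) e^{-W}` and the near-axis bound

Topic `Literature/NumberTheory/Sieve`; a PROVED tool file toward Hildebrand–Tenenbaum's saddle-point
theorem [HildebrandTenenbaum1986, Thm 1]. For `s = σ + it`, `σ > 0`, and `ζ(s, y) = Π_{p ≤ y} (1 - p^{-s})⁻¹`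
(the tree's `smoothZetaC`; `g_p = log² p · p^σ/(p^σ - 1)²` is the `p`-term of `φ₂(σ, y)`):

* `inv_norm_one_sub_cpow_le_exp_neg` — the per-prime bound AT FULL STRENGTH and for every `σ > 0`:
  `‖1 - p^{-s}‖⁻¹ ≤ (1 - p^{-σ})⁻¹ · exp(-p^{-σ}(1 - cos(t log p)))`
  (from `-log(1 - z) = Σ zⁿ/n`: `log‖1 - p^{-s}‖ - log(1 - p^{-σ}) = Σ_n p^{-nσ}(1 - cos(nt log p))/n ≥`
  its first term); hence `norm_smoothZetaC_le_mul_exp_neg_decaySum`: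
  **`|ζ(σ + it, y)| ≤ ζ(σ, y) · exp(-W)`, `W = Σ_{p ≤ y} p^{-σ}(1 - cos(t log p))`** — op. cit. proof of
  (3.16): "whence `|ζ(s,y)/ζ(α,y)| ≤ e^{-W}` with `W := Σ_{p ≤ y} (1 - cos(τ log p)) p^{-α}`" — with no loss
  of constant and no restriction `σ ≥ 3/5` (compare the tree's `norm_smoothZetaC_le_mul_exp_weight`).
* `inv_norm_one_sub_cpow_le_exp_log` — near the real axis (`|t| log p ≤ π`):
  `‖1 - p^{-s}‖⁻¹ ≤ (1 - p^{-σ})⁻¹ exp(-½ log(1 + v_p))`, `v_p = (4/π²) t² g_p`, i.e. the factor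
  `(1 + v_p)^{-1/2}` kept exactly instead of `exp(-¼ min(1, v_p))` (`SmoothZetaDecayNearAxis`); hence, by
  concavity of `log(1 + v)` (`mul_log_one_add_le_log_one_add`), `norm_smoothZetaC_le_mul_rpow_of_weight_le`:
  **if every `g_p ≤ φ₂(σ, y)/K` then `|ζ(σ + it, y)| ≤ ζ(σ, y) (1 + 4t²φ₂(σ, y)/(π²K))^{-K/2}`** for
  `|t| log y ≤ π` — a Gaussian while `t²φ₂ ≲ K` and the power `(t²φ₂/K)^{-K/2}` beyond: Lemma 8 (i) (3.15)
  in a form whose integral over `|t| ≤ π/log y` is `≪ 1/√φ₂` (`integral_rpow_neg_le`) with no additive term.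
* The two regimes of op. cit. (proof of (3.15)) for ANY `σ > 0`, `y ≥ 2`, `|t| log y ≤ π`:
  `norm_smoothZetaC_le_mul_rpow_of_mul_log_le_one` — `σ log y ≤ 1`: `g_p ≤ 3/σ²`, `φ₂ ≥ π(y)/(9σ²)`
  (`phi₂Weight_bounds_of_mul_log_le_one`), `K = π(y)/27`:
  `|ζ(σ+it, y)| ≤ ζ(σ, y)(1 + 108 t²φ₂/(π² π(y)))^{-π(y)/54}`;
  `norm_smoothZetaC_le_mul_rpow_of_one_le_mul_log` — `σ log y ≥ 1`: `g_p ≤ 20 log² y`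
  (`phi₂Weight_le_twenty_mul_log_sq`), `K = φ₂/(20 log² y)`:
  `|ζ(σ+it, y)| ≤ ζ(σ, y)(1 + 80 t² log² y/π²)^{-φ₂/(40 log² y)} ≤ ζ(σ, y) exp(-t² φ₂/100)`
  (`norm_smoothZetaC_le_mul_exp_neg_of_one_le_mul_log`).
* `exists_norm_smoothZetaC_saddlePoint_near_axis_le` — the weaker two-term form at the saddle point,
  uniformly in `x ≥ y ≥ y₀`: `|ζ(α + it, y)| ≤ ζ(α, y) (exp(-t² φ₂/(160 π²)) + exp(-π(y)/108))`
  (from `norm_smoothZetaC_le_mul_exp_neg_sum_min` of `SmoothZetaDecayNearAxis`).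
* `integral_rpow_neg_le` — the majorant integrates: `∫_ℝ (1 + a t²)^{-K/2} dt ≤ π/√a` (`K ≥ 2`, `a > 0`).

## References

* [HildebrandTenenbaum1986] A. Hildebrand, G. Tenenbaum, Trans. AMS 296 (1986) 265–290, §3 Lemma 8,
  (3.14)–(3.17) and the proof of (3.15)–(3.16) (held: `paper:doi-10-1090-s0002-9947-1986-0837811-1`,
  pp. 275–276).

## Tree / Mathlib

Tree: `smoothZetaC`, `natCast_cpow_neg_add_mul_I`, `norm_natCast_cpow_neg`, `one_sub_cpow_ne_zero`,
`norm_sq_one_sub_cpow_eq_mul`, `two_div_pi_sq_mul_sq_le_one_sub_cos` (`SmoothZetaComplex`);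
`norm_smoothZetaC_le_mul_exp_neg_sum_min` (`SmoothZetaDecayNearAxis`); `saddlePhi₂`,
`le_saddlePhi₂_saddlePoint_uniform`, `rpow_sub_one_bounds` (`SmoothSaddlePointUniform`),
`rpow_le_three_of_mul_log_le_one`, `exists_sqrt_div_four_le_log`, `exists_log_le_mul_rpow`,
`card_filter_rpow_lt_le` (`SmoothSaddlePointPhiHigher`). Mathlib: `Complex.hasSum_taylorSeries_neg_log`,
`Complex.hasSum_iff`, `le_hasSum`, `Complex.log_re`, `Complex.log_ofReal_re`, `Real.strictConcaveOn_log_Ioi`,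
`integral_univ_inv_one_add_sq`, `MeasureTheory.Measure.integral_comp_mul_left`, `Real.exp_bound`.
-/

noncomputable section

open Complex Finset Real MeasureTheory

namespace Literature.NumberTheory.Sieve

variable {α : ℝ} {y p : ℕ}

/-- `e^{-m} ≤ e^{-a} + e^{-b}` when `min(a, b) ≤ m`. [folklore] -/
theorem exp_neg_le_add_of_min_le {a b m : ℝ} (h : min a b ≤ m) :
    Real.exp (-m) ≤ Real.exp (-a) + Real.exp (-b) := by
  rcases le_total a b with hab | hab
  · rw [min_eq_left hab] at h
    have : Real.exp (-m) ≤ Real.exp (-a) := Real.exp_le_exp.2 (by linarith)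
    linarith [Real.exp_pos (-b)]
  · rw [min_eq_right hab] at h
    have : Real.exp (-m) ≤ Real.exp (-b) := Real.exp_le_exp.2 (by linarith)
    linarith [Real.exp_pos (-a)]

/-- The `φ₂`-weight `w_p = log² p · p^α/(p^α - 1)²` is nonnegative (`α > 0`). [folklore] -/
theorem phi₂Weight_nonneg (hp : p ∈ Nat.primesLE y) (hα : 0 < α) :
    0 ≤ Real.log p ^ 2 * ((p : ℝ) ^ α / ((p : ℝ) ^ α - 1) ^ 2) := by
  have hp2 : (2 : ℝ) ≤ p := by exact_mod_cast (Nat.mem_primesLE.1 hp).2.two_le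
  have hP1 : 1 < (p : ℝ) ^ α := Real.one_lt_rpow (by linarith) hα
  have : 0 < (p : ℝ) ^ α - 1 := by linarith
  positivity

/-- Regime `α log y ≤ 1`: `1/(9α²) ≤ w_p ≤ 3/α²` (`α log p ≤ p^α - 1 ≤ 3α log p`, `1 ≤ p^α ≤ 3`).
[cite: HildebrandTenenbaum1986, Lemma 8, proof of (3.15)] -/
theorem phi₂Weight_bounds_of_mul_log_le_one (hp : p ∈ Nat.primesLE y) (hα : 0 < α)
    (hA : α * Real.log y ≤ 1) :
    1 / (9 * α ^ 2) ≤ Real.log p ^ 2 * ((p : ℝ) ^ α / ((p : ℝ) ^ α - 1) ^ 2) ∧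
      Real.log p ^ 2 * ((p : ℝ) ^ α / ((p : ℝ) ^ α - 1) ^ 2) ≤ 3 / α ^ 2 := by
  obtain ⟨h1, h3⟩ := rpow_sub_one_bounds hp hα hA
  have hp2 : (2 : ℝ) ≤ p := by exact_mod_cast (Nat.mem_primesLE.1 hp).2.two_le
  have hlogp : 0 < Real.log p := Real.log_pos (by linarith)
  have hQ3 := rpow_le_three_of_mul_log_le_one hp hα hA
  have hD : 0 < (p : ℝ) ^ α - 1 := lt_of_lt_of_le (mul_pos hα hlogp) h1
  have hQ1 : 1 ≤ (p : ℝ) ^ α := by linarith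
  constructor
  · calc 1 / (9 * α ^ 2) = Real.log p ^ 2 * (1 / (3 * (α * Real.log p)) ^ 2) := by field_simp; ring
      _ ≤ Real.log p ^ 2 * ((p : ℝ) ^ α / ((p : ℝ) ^ α - 1) ^ 2) := by
          apply mul_le_mul_of_nonneg_left _ (by positivity)
          calc 1 / (3 * (α * Real.log p)) ^ 2 ≤ 1 / ((p : ℝ) ^ α - 1) ^ 2 := by
                apply div_le_div_of_nonneg_left zero_le_one (by positivity)
                exact pow_le_pow_left₀ hD.le h3 2
            _ ≤ (p : ℝ) ^ α / ((p : ℝ) ^ α - 1) ^ 2 := div_le_div_of_nonneg_right hQ1 (by positivity)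
  · calc Real.log p ^ 2 * ((p : ℝ) ^ α / ((p : ℝ) ^ α - 1) ^ 2)
        ≤ Real.log p ^ 2 * (3 / (α * Real.log p) ^ 2) := by
          apply mul_le_mul_of_nonneg_left _ (by positivity)
          calc (p : ℝ) ^ α / ((p : ℝ) ^ α - 1) ^ 2 ≤ 3 / ((p : ℝ) ^ α - 1) ^ 2 :=
                div_le_div_of_nonneg_right hQ3 (by positivity)
            _ ≤ 3 / (α * Real.log p) ^ 2 := by
                apply div_le_div_of_nonneg_left (by norm_num) (by positivity)
                exact pow_le_pow_left₀ (by positivity) h1 2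
      _ = 3 / α ^ 2 := by field_simp

/-- Primes with `p^α ≥ 5/4`: `w_p ≤ 20 log² p` (`p^α/(p^α-1)² ≤ 25/p^α ≤ 20`). [folklore] -/
theorem phi₂Weight_le_of_le_rpow (hp : p ∈ Nat.primesLE y) (hP : (5 : ℝ) / 4 ≤ (p : ℝ) ^ α) :
    Real.log p ^ 2 * ((p : ℝ) ^ α / ((p : ℝ) ^ α - 1) ^ 2) ≤ 20 * Real.log p ^ 2 := by
  have hp2 : (2 : ℝ) ≤ p := by exact_mod_cast (Nat.mem_primesLE.1 hp).2.two_le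
  have hQ0 : 0 < (p : ℝ) ^ α := Real.rpow_pos_of_pos (by linarith) α
  have hD : (p : ℝ) ^ α / 5 ≤ (p : ℝ) ^ α - 1 := by linarith
  have hD0 : 0 < (p : ℝ) ^ α - 1 := by linarith
  have hQ' : (p : ℝ) ^ α / ((p : ℝ) ^ α - 1) ^ 2 ≤ 20 := by
    rw [div_le_iff₀ (by positivity)]
    nlinarith [pow_le_pow_left₀ (by positivity : 0 ≤ (p : ℝ) ^ α / 5) hD 2]
  calc Real.log p ^ 2 * ((p : ℝ) ^ α / ((p : ℝ) ^ α - 1) ^ 2) ≤ Real.log p ^ 2 * 20 :=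
        mul_le_mul_of_nonneg_left hQ' (by positivity)
    _ = 20 * Real.log p ^ 2 := by ring

/-- Primes with `p^α < 5/4`: `w_p ≤ (5/4)/α²` (`p^α - 1 ≥ α log p`). [folklore] -/
theorem phi₂Weight_le_of_rpow_lt (hp : p ∈ Nat.primesLE y) (hα : 0 < α) (hP : (p : ℝ) ^ α < 5 / 4) :
    Real.log p ^ 2 * ((p : ℝ) ^ α / ((p : ℝ) ^ α - 1) ^ 2) ≤ 5 / 4 * (1 / α) ^ 2 := by
  have hp2 : (2 : ℝ) ≤ p := by exact_mod_cast (Nat.mem_primesLE.1 hp).2.two_le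
  have hp0 : (0 : ℝ) < p := by linarith
  have hlogp : 0 < Real.log p := Real.log_pos (by linarith)
  have hD : α * Real.log p ≤ (p : ℝ) ^ α - 1 := by
    rw [Real.rpow_def_of_pos hp0]
    have := Real.add_one_le_exp (Real.log p * α)
    nlinarith
  have hD0 : 0 < (p : ℝ) ^ α - 1 := lt_of_lt_of_le (mul_pos hα hlogp) hD
  calc Real.log p ^ 2 * ((p : ℝ) ^ α / ((p : ℝ) ^ α - 1) ^ 2)
      ≤ Real.log p ^ 2 * ((5 / 4) / (α * Real.log p) ^ 2) := by
        apply mul_le_mul_of_nonneg_left _ (by positivity)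
        calc (p : ℝ) ^ α / ((p : ℝ) ^ α - 1) ^ 2 ≤ (5 / 4) / ((p : ℝ) ^ α - 1) ^ 2 :=
              div_le_div_of_nonneg_right hP.le (by positivity)
          _ ≤ (5 / 4) / (α * Real.log p) ^ 2 := by
              apply div_le_div_of_nonneg_left (by norm_num) (by positivity)
              exact pow_le_pow_left₀ (by positivity) hD 2
    _ = 5 / 4 * (1 / α) ^ 2 := by field_simp

/-- `min(1, v) ≥ v/V` when `0 ≤ v ≤ V` and `V ≥ 1`. [folklore] -/
theorem div_le_min_one {v V : ℝ} (hv0 : 0 ≤ v) (hvV : v ≤ V) (hV : 1 ≤ V) : v / V ≤ min 1 v := by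
  have hV0 : 0 < V := by linarith
  rcases le_or_gt v 1 with h1 | h1
  · rw [min_eq_right h1, div_le_iff₀ hV0]; nlinarith
  · rw [min_eq_left h1.le, div_le_iff₀ hV0]; linarith

/-- **Lemma 8 (i) at the saddle point, uniformly.** There is `y₀` such that for `x ≥ y ≥ y₀` and
`|t| log y ≤ π`, with `α = α(x, y)`:
`|ζ(α + it, y)| ≤ ζ(α, y) (exp(-t² φ₂(α, y)/(160π²)) + exp(-π(y)/108))`.
[cite: HildebrandTenenbaum1986, Lemma 8 (i) (3.15)] -/
theorem exists_norm_smoothZetaC_saddlePoint_near_axis_le :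
    ∃ y₀ : ℕ, 2 ≤ y₀ ∧ ∀ (x : ℝ) (y : ℕ) (t : ℝ), y₀ ≤ y → (y : ℝ) ≤ x → |t| * Real.log y ≤ Real.pi →
      ‖smoothZetaC ((saddlePoint x y : ℂ) + t * I) y‖ ≤ smoothZeta (saddlePoint x y) y *
        (Real.exp (-(t ^ 2 * saddlePhi₂ (saddlePoint x y) y / (160 * Real.pi ^ 2))) +
          Real.exp (-((#(Nat.primesLE y) : ℝ) / 108))) := by
  obtain ⟨c₁, y₁, hc₁, hy₁2, hφlow⟩ := le_saddlePhi₂_saddlePoint_uniform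
  obtain ⟨y₂, hy₂2, hsqrt⟩ := exists_sqrt_div_four_le_log
  obtain ⟨Y, hY1, hY⟩ := exists_log_le_mul_rpow (κ := c₁ / 20) (ε := 1 / 4) (by positivity) (by norm_num)
  refine ⟨max (max y₁ y₂) (max ⌈Y⌉₊ 3), le_trans hy₁2 ((le_max_left _ _).trans (le_max_left _ _)),
    fun x y t hy hyx ht => ?_⟩
  have hy₁ : y₁ ≤ y := le_trans ((le_max_left _ _).trans (le_max_left _ _)) hy
  have hy₂ : y₂ ≤ y := le_trans ((le_max_right _ _).trans (le_max_left _ _)) hy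
  have hyY : Y ≤ y := le_trans (Nat.le_ceil Y)
    (by exact_mod_cast le_trans ((le_max_left _ _).trans (le_max_right _ _)) hy)
  have hy3 : 3 ≤ y := le_trans ((le_max_right _ _).trans (le_max_right _ _)) hy
  have hy2 : 2 ≤ y := le_trans (by norm_num) hy3
  have hy1 : (1 : ℝ) < y := by exact_mod_cast lt_of_lt_of_le (by norm_num) hy3
  have hy0 : (0 : ℝ) < y := by linarith
  have hx1 : 1 < x := by linarith
  have hℓ : 0 < Real.log y := Real.log_pos hy1
  have hL : 0 < Real.log x := Real.log_pos hx1
  have hα0 : 0 < saddlePoint x y := saddlePoint_pos hx1 hy2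
  have hφ0 : 0 < saddlePhi₂ (saddlePoint x y) y := saddlePhi₂_pos hy2 hα0
  have hπ : 0 < Real.pi := Real.pi_pos
  -- `S = Σ min(1, v_p)` and the basic estimate
  set S : ℝ := ∑ p ∈ Nat.primesLE y, min 1 (4 / Real.pi ^ 2 * t ^ 2 *
    (Real.log p ^ 2 * ((p : ℝ) ^ saddlePoint x y / ((p : ℝ) ^ saddlePoint x y - 1) ^ 2))) with hS
  have hmain := norm_smoothZetaC_le_mul_exp_neg_sum_min (y := y) hα0 ht
  rw [← hS] at hmain
  have hmin0 : ∀ p ∈ Nat.primesLE y, 0 ≤ min 1 (4 / Real.pi ^ 2 * t ^ 2 *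
      (Real.log p ^ 2 * ((p : ℝ) ^ saddlePoint x y / ((p : ℝ) ^ saddlePoint x y - 1) ^ 2))) :=
    fun p hp => le_min zero_le_one (by have := phi₂Weight_nonneg hp hα0; positivity)
  -- it suffices to bound `S/4` from below by the minimum of the two exponents
  suffices hSuff : min (t ^ 2 * saddlePhi₂ (saddlePoint x y) y / (160 * Real.pi ^ 2))
      ((#(Nat.primesLE y) : ℝ) / 108) ≤ 1 / 4 * S by
    calc ‖smoothZetaC ((saddlePoint x y : ℂ) + t * I) y‖
        ≤ smoothZeta (saddlePoint x y) y * Real.exp (-(1 / 4) * S) := hmain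
      _ = smoothZeta (saddlePoint x y) y * Real.exp (-(1 / 4 * S)) := by ring_nf
      _ ≤ _ := mul_le_mul_of_nonneg_left (exp_neg_le_add_of_min_le hSuff) (smoothZeta_pos hα0).le
  have ht2 : t ^ 2 * Real.log y ^ 2 ≤ Real.pi ^ 2 := by
    have h := pow_le_pow_left₀ (by positivity) ht 2
    rw [mul_pow, sq_abs] at h
    exact h
  by_cases hA : saddlePoint x y * Real.log y ≤ 1
  · -- regime `α log y ≤ 1`
    by_cases hsmall : t ^ 2 ≤ Real.pi ^ 2 * saddlePoint x y ^ 2 / 12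
    · -- all `v_p ≤ 1`: `S = (4/π²) t² φ₂`
      have hS_eq : S = 4 / Real.pi ^ 2 * t ^ 2 * saddlePhi₂ (saddlePoint x y) y := by
        rw [hS, saddlePhi₂_def, Finset.mul_sum]
        refine Finset.sum_congr rfl fun p hp => min_eq_right ?_
        have hw := (phi₂Weight_bounds_of_mul_log_le_one hp hα0 hA).2
        have hw0 := phi₂Weight_nonneg hp hα0
        calc 4 / Real.pi ^ 2 * t ^ 2 *
              (Real.log p ^ 2 * ((p : ℝ) ^ saddlePoint x y / ((p : ℝ) ^ saddlePoint x y - 1) ^ 2))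
            ≤ 4 / Real.pi ^ 2 * (Real.pi ^ 2 * saddlePoint x y ^ 2 / 12) * (3 / saddlePoint x y ^ 2) := by
              gcongr
          _ = 1 := by field_simp; norm_num
      refine le_trans (min_le_left _ _) ?_
      rw [hS_eq]
      have h160 : t ^ 2 * saddlePhi₂ (saddlePoint x y) y / (160 * Real.pi ^ 2) ≤
          t ^ 2 * saddlePhi₂ (saddlePoint x y) y / Real.pi ^ 2 := by
        apply div_le_div_of_nonneg_left (by positivity) (by positivity); nlinarith
      have heq : t ^ 2 * saddlePhi₂ (saddlePoint x y) y / Real.pi ^ 2 =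
          1 / 4 * (4 / Real.pi ^ 2 * t ^ 2 * saddlePhi₂ (saddlePoint x y) y) := by ring
      linarith
    · -- all `v_p ≥ 1/27`: `S ≥ π(y)/27`
      push Not at hsmall
      have hvp : ∀ p ∈ Nat.primesLE y, (1 / 27 : ℝ) ≤ min 1 (4 / Real.pi ^ 2 * t ^ 2 *
          (Real.log p ^ 2 * ((p : ℝ) ^ saddlePoint x y / ((p : ℝ) ^ saddlePoint x y - 1) ^ 2))) := by
        intro p hp
        refine le_min (by norm_num) ?_
        have hw := (phi₂Weight_bounds_of_mul_log_le_one hp hα0 hA).1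
        calc (1 / 27 : ℝ) = 4 / Real.pi ^ 2 * (Real.pi ^ 2 * saddlePoint x y ^ 2 / 12) *
              (1 / (9 * saddlePoint x y ^ 2)) := by field_simp; norm_num
          _ ≤ 4 / Real.pi ^ 2 * t ^ 2 *
              (Real.log p ^ 2 * ((p : ℝ) ^ saddlePoint x y / ((p : ℝ) ^ saddlePoint x y - 1) ^ 2)) := by
              gcongr
      have hS_ge : (#(Nat.primesLE y) : ℝ) / 27 ≤ S := by
        calc (#(Nat.primesLE y) : ℝ) / 27 = ∑ p ∈ Nat.primesLE y, (1 / 27 : ℝ) := by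
              rw [Finset.sum_const, nsmul_eq_mul]; ring
          _ ≤ S := Finset.sum_le_sum hvp
      refine le_trans (min_le_right _ _) ?_
      linarith
  · -- regime `α log y > 1`
    push Not at hA
    have hαℓ : 1 / Real.log y < saddlePoint x y := by rw [div_lt_iff₀ hℓ]; linarith
    have h1α : 1 / saddlePoint x y ≤ Real.log y := by rw [div_le_iff₀ hα0]; linarith
    -- the good primes carry `S ≥ (4/π²) t² (Σ_G w_p)/80`
    have hSG : 4 / Real.pi ^ 2 * t ^ 2 * (∑ p ∈ (Nat.primesLE y).filter
        (fun p : ℕ => (5 : ℝ) / 4 ≤ (p : ℝ) ^ saddlePoint x y),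
        Real.log p ^ 2 * ((p : ℝ) ^ saddlePoint x y / ((p : ℝ) ^ saddlePoint x y - 1) ^ 2)) / 80 ≤ S := by
      rw [Finset.mul_sum, Finset.sum_div, hS]
      refine le_trans (Finset.sum_le_sum fun p hp => ?_)
        (Finset.sum_le_sum_of_subset_of_nonneg (Finset.filter_subset _ _) fun p hp _ => hmin0 p hp)
      rw [Finset.mem_filter] at hp
      obtain ⟨hp, hP54⟩ := hp
      obtain ⟨hpy, hpp⟩ := Nat.mem_primesLE.1 hp
      have hp0 : (0 : ℝ) < p := by exact_mod_cast hpp.pos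
      have hlogp : 0 ≤ Real.log p := Real.log_nonneg (by exact_mod_cast hpp.one_lt.le)
      have hlogpy : Real.log p ≤ Real.log y := Real.log_le_log hp0 (by exact_mod_cast hpy)
      refine div_le_min_one (by have := phi₂Weight_nonneg hp hα0; positivity) ?_ (by norm_num)
      calc 4 / Real.pi ^ 2 * t ^ 2 *
            (Real.log p ^ 2 * ((p : ℝ) ^ saddlePoint x y / ((p : ℝ) ^ saddlePoint x y - 1) ^ 2))
          ≤ 4 / Real.pi ^ 2 * t ^ 2 * (20 * Real.log p ^ 2) :=
            mul_le_mul_of_nonneg_left (phi₂Weight_le_of_le_rpow hp hP54) (by positivity)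
        _ ≤ 4 / Real.pi ^ 2 * t ^ 2 * (20 * Real.log y ^ 2) := by gcongr
        _ = 80 * (t ^ 2 * Real.log y ^ 2) / Real.pi ^ 2 := by ring
        _ ≤ 80 * Real.pi ^ 2 / Real.pi ^ 2 := by gcongr
        _ = 80 := by field_simp
    -- the bad primes carry at most `φ₂/2`
    have hBle : ∑ p ∈ (Nat.primesLE y).filter (fun p : ℕ => ¬ ((5 : ℝ) / 4 ≤ (p : ℝ) ^ saddlePoint x y)),
        Real.log p ^ 2 * ((p : ℝ) ^ saddlePoint x y / ((p : ℝ) ^ saddlePoint x y - 1) ^ 2) ≤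
        saddlePhi₂ (saddlePoint x y) y / 2 := by
      rcases ((Nat.primesLE y).filter
          (fun p : ℕ => ¬ ((5 : ℝ) / 4 ≤ (p : ℝ) ^ saddlePoint x y))).eq_empty_or_nonempty with hBe | ⟨q, hq⟩
      · rw [hBe, Finset.sum_empty]; positivity
      have hq' : ∃ q ∈ Nat.primesLE y, (q : ℝ) ^ saddlePoint x y < 5 / 4 := by
        rw [Finset.mem_filter, not_le] at hq
        exact ⟨q, hq.1, hq.2⟩
      have hLsqrt : Real.sqrt y / 4 ≤ Real.log x := hsqrt x y hy₂ hyx hq'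
      have hcard := card_filter_rpow_lt_le (x := x) hy2 hαℓ
      have hy14 : 1 ≤ (y : ℝ) ^ (1 / 4 : ℝ) := Real.one_le_rpow hy1.le (by norm_num)
      have hlogy_le : Real.log y ≤ c₁ / 20 * (y : ℝ) ^ (1 / 4 : ℝ) := hY y hyY
      have hsq : (y : ℝ) ^ (1 / 4 : ℝ) * (y : ℝ) ^ (1 / 4 : ℝ) = Real.sqrt y := by
        rw [← Real.rpow_add hy0, Real.sqrt_eq_rpow]; norm_num
      have hφlow' : c₁ * (Real.log x * Real.log y) ≤ saddlePhi₂ (saddlePoint x y) y := hφlow x y hy₁ hyx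
      calc ∑ p ∈ (Nat.primesLE y).filter (fun p : ℕ => ¬ ((5 : ℝ) / 4 ≤ (p : ℝ) ^ saddlePoint x y)),
            Real.log p ^ 2 * ((p : ℝ) ^ saddlePoint x y / ((p : ℝ) ^ saddlePoint x y - 1) ^ 2)
          ≤ ∑ p ∈ (Nat.primesLE y).filter (fun p : ℕ => ¬ ((5 : ℝ) / 4 ≤ (p : ℝ) ^ saddlePoint x y)),
            5 / 4 * Real.log y ^ 2 := by
            refine Finset.sum_le_sum fun p hp => ?_
            rw [Finset.mem_filter, not_le] at hp
            calc _ ≤ 5 / 4 * (1 / saddlePoint x y) ^ 2 := phi₂Weight_le_of_rpow_lt hp.1 hα0 hp.2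
              _ ≤ 5 / 4 * Real.log y ^ 2 := by gcongr
        _ = #((Nat.primesLE y).filter (fun p : ℕ => ¬ ((5 : ℝ) / 4 ≤ (p : ℝ) ^ saddlePoint x y))) *
            (5 / 4 * Real.log y ^ 2) := by rw [Finset.sum_const, nsmul_eq_mul]
        _ ≤ ((y : ℝ) ^ (1 / 4 : ℝ) + 1) * (5 / 4 * Real.log y ^ 2) :=
            mul_le_mul_of_nonneg_right hcard (by positivity)
        _ ≤ (2 * (y : ℝ) ^ (1 / 4 : ℝ)) * (5 / 4 * Real.log y ^ 2) := by gcongr; linarith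
        _ = 5 / 2 * ((y : ℝ) ^ (1 / 4 : ℝ) * Real.log y) * Real.log y := by ring
        _ ≤ 5 / 2 * ((y : ℝ) ^ (1 / 4 : ℝ) * (c₁ / 20 * (y : ℝ) ^ (1 / 4 : ℝ))) * Real.log y := by gcongr
        _ = c₁ / 2 * (Real.sqrt y / 4 * Real.log y) := by rw [← hsq]; ring
        _ ≤ c₁ / 2 * (Real.log x * Real.log y) := by gcongr
        _ ≤ saddlePhi₂ (saddlePoint x y) y / 2 := by linarith
    have hsplit : ∑ p ∈ (Nat.primesLE y).filter (fun p : ℕ => (5 : ℝ) / 4 ≤ (p : ℝ) ^ saddlePoint x y),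
        Real.log p ^ 2 * ((p : ℝ) ^ saddlePoint x y / ((p : ℝ) ^ saddlePoint x y - 1) ^ 2) +
        ∑ p ∈ (Nat.primesLE y).filter (fun p : ℕ => ¬ ((5 : ℝ) / 4 ≤ (p : ℝ) ^ saddlePoint x y)),
        Real.log p ^ 2 * ((p : ℝ) ^ saddlePoint x y / ((p : ℝ) ^ saddlePoint x y - 1) ^ 2) =
        saddlePhi₂ (saddlePoint x y) y := by
      rw [saddlePhi₂_def]; exact Finset.sum_filter_add_sum_filter_not _ _ _
    have hGhalf : saddlePhi₂ (saddlePoint x y) y / 2 ≤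
        ∑ p ∈ (Nat.primesLE y).filter (fun p : ℕ => (5 : ℝ) / 4 ≤ (p : ℝ) ^ saddlePoint x y),
        Real.log p ^ 2 * ((p : ℝ) ^ saddlePoint x y / ((p : ℝ) ^ saddlePoint x y - 1) ^ 2) := by
      linarith
    refine le_trans (min_le_left _ _) ?_
    calc t ^ 2 * saddlePhi₂ (saddlePoint x y) y / (160 * Real.pi ^ 2)
        = 1 / 4 * (4 / Real.pi ^ 2 * t ^ 2 * (saddlePhi₂ (saddlePoint x y) y / 2) / 80) := by
          field_simp; ring
      _ ≤ 1 / 4 * (4 / Real.pi ^ 2 * t ^ 2 * (∑ p ∈ (Nat.primesLE y).filter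
            (fun p : ℕ => (5 : ℝ) / 4 ≤ (p : ℝ) ^ saddlePoint x y),
            Real.log p ^ 2 * ((p : ℝ) ^ saddlePoint x y / ((p : ℝ) ^ saddlePoint x y - 1) ^ 2)) / 80) := by
          gcongr
      _ ≤ 1 / 4 * S := by linarith


variable {σ t : ℝ}

/-! ### The per-prime bound at full strength: `‖1 - p^{-s}‖⁻¹ ≤ (1 - p^{-σ})⁻¹ e^{-p^{-σ}(1 - cos(t log p))}` -/

/-- **The Euler factor at full strength, every `σ > 0`**: for a prime `p` and `s = σ + it`,
`‖1 - p^{-s}‖⁻¹ ≤ (1 - p^{-σ})⁻¹ · exp(-p^{-σ}(1 - cos(t log p)))`. With `z = p^{-s}`, `a = p^{-σ} = ‖z‖`,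
`-log(1 - z) = Σ_{n ≥ 1} zⁿ/n` gives `log‖1 - z‖⁻¹ = Σ Re(zⁿ)/n ≤ Σ aⁿ/n - (a - Re z) = log(1 - a)⁻¹ - a(1 - cos(t log p))`
(every term `aⁿ - Re zⁿ ≥ 0`; keep only `n = 1`). [cite: HildebrandTenenbaum1986, §3 (3.14) and proof of (3.16)] -/
theorem inv_norm_one_sub_cpow_le_exp_neg (hp : 2 ≤ p) (hσ : 0 < σ) (t : ℝ) :
    ‖1 - (p : ℂ) ^ (-((σ : ℂ) + t * I))‖⁻¹ ≤
      (1 - (p : ℝ) ^ (-σ))⁻¹ * Real.exp (-((p : ℝ) ^ (-σ) * (1 - Real.cos (t * Real.log p)))) := by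
  have hp0 : 0 < p := by omega
  have hp1r : (1 : ℝ) < p := by exact_mod_cast lt_of_lt_of_le one_lt_two hp
  have hp0r : (0 : ℝ) < p := by linarith
  set a : ℝ := (p : ℝ) ^ (-σ) with ha
  set θ : ℝ := t * Real.log p with hθ
  set z : ℂ := (p : ℂ) ^ (-((σ : ℂ) + t * I)) with hz
  have ha0 : 0 < a := Real.rpow_pos_of_pos hp0r _
  have ha1 : a < 1 := Real.rpow_lt_one_of_one_lt_of_neg hp1r (by linarith)
  have h1a : 0 < 1 - a := by linarith
  have hzeq : z = ((a : ℝ) : ℂ) * (Real.cos θ - Real.sin θ * I) := natCast_cpow_neg_add_mul_I hp0 σ t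
  have hznorm : ‖z‖ = a := by
    rw [hz, norm_natCast_cpow_neg hp0]; simp [ha]
  have hz1 : ‖z‖ < 1 := by rw [hznorm]; exact ha1
  have hzre : z.re = a * Real.cos θ := by
    rw [hzeq]; simp [Complex.cos_ofReal_re]
  have haC : ‖((a : ℝ) : ℂ)‖ < 1 := by
    rw [Complex.norm_real, Real.norm_eq_abs, abs_of_pos ha0]; exact ha1
  -- the two logarithmic series and their real parts
  have hSz := ((Complex.hasSum_iff _ _).1 (Complex.hasSum_taylorSeries_neg_log hz1)).1
  have hSa := ((Complex.hasSum_iff _ _).1 (Complex.hasSum_taylorSeries_neg_log haC)).1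
  have hdiff := hSa.sub hSz
  -- every term of the difference is nonnegative
  have hterm_a : ∀ n : ℕ, ((((a : ℝ) : ℂ)) ^ n / (n : ℂ)).re = a ^ n / n := by
    intro n
    rw [← Complex.ofReal_pow, ← Complex.ofReal_natCast, ← Complex.ofReal_div, Complex.ofReal_re]
  have hterm_z : ∀ n : ℕ, (z ^ n / (n : ℂ)).re ≤ a ^ n / n := by
    intro n
    calc (z ^ n / (n : ℂ)).re ≤ ‖z ^ n / (n : ℂ)‖ := Complex.re_le_norm _
      _ = a ^ n / n := by rw [norm_div, norm_pow, hznorm, Complex.norm_natCast]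
  have hnonneg : ∀ n : ℕ, 0 ≤ ((((a : ℝ) : ℂ)) ^ n / (n : ℂ)).re - (z ^ n / (n : ℂ)).re := by
    intro n; rw [hterm_a]; linarith [hterm_z n]
  -- the first term is `a(1 - cos θ)`
  have hfirst : ((((a : ℝ) : ℂ)) ^ 1 / ((1 : ℕ) : ℂ)).re - (z ^ 1 / ((1 : ℕ) : ℂ)).re =
      a * (1 - Real.cos θ) := by
    rw [hterm_a 1]; simp [hzre]; ring
  have hle := le_hasSum hdiff 1 (fun n _ => hnonneg n)
  rw [hfirst] at hle
  -- identify the sums: `Re(-log(1 - a)) = -log(1 - a)`, `Re(-log(1 - z)) = -log‖1 - z‖`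
  have hlog_a : (-Complex.log (1 - ((a : ℝ) : ℂ))).re = -Real.log (1 - a) := by
    rw [Complex.neg_re, show (1 : ℂ) - ((a : ℝ) : ℂ) = (((1 - a : ℝ)) : ℂ) by push_cast; ring,
      Complex.log_ofReal_re]
  have hlog_z : (-Complex.log (1 - z)).re = -Real.log ‖1 - z‖ := by
    rw [Complex.neg_re, Complex.log_re]
  rw [hlog_a, hlog_z] at hle
  -- exponentiate
  have hnz : 0 < ‖1 - z‖ := by
    have hsre : 0 < ((σ : ℂ) + t * I).re := by simp [hσ]
    exact norm_pos_iff.2 (one_sub_cpow_ne_zero hp hsre)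
  have hkey : (1 - a) * Real.exp (a * (1 - Real.cos θ)) ≤ ‖1 - z‖ := by
    have h1 : Real.log (1 - a) + a * (1 - Real.cos θ) ≤ Real.log ‖1 - z‖ := by linarith
    calc (1 - a) * Real.exp (a * (1 - Real.cos θ))
        = Real.exp (Real.log (1 - a) + a * (1 - Real.cos θ)) := by
          rw [Real.exp_add, Real.exp_log h1a]
      _ ≤ Real.exp (Real.log ‖1 - z‖) := Real.exp_le_exp.2 h1
      _ = ‖1 - z‖ := Real.exp_log hnz
  have hpos : 0 < (1 - a) * Real.exp (a * (1 - Real.cos θ)) := by positivity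
  calc ‖1 - z‖⁻¹ ≤ ((1 - a) * Real.exp (a * (1 - Real.cos θ)))⁻¹ := inv_anti₀ hpos hkey
    _ = (1 - a)⁻¹ * Real.exp (-(a * (1 - Real.cos θ))) := by
        rw [mul_inv, Real.exp_neg]

/-- **`|ζ(σ + it, y)| ≤ ζ(σ, y) · exp(-Σ_{p ≤ y} p^{-σ}(1 - cos(t log p)))`** for every `σ > 0`, `t` and `y`:
the product of `inv_norm_one_sub_cpow_le_exp_neg` over `p ≤ y`. This is Hildebrand–Tenenbaum's
"`|ζ(s,y)/ζ(α,y)| ≤ e^{-W}`, `W := Σ_{p ≤ y} (1 - cos(τ log p)) p^{-α}`", here for all `σ > 0` and with no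
loss of constant. [cite: HildebrandTenenbaum1986, §3 Lemma 8 (ii), proof of (3.16)] -/
theorem norm_smoothZetaC_le_mul_exp_neg_decaySum (hσ : 0 < σ) (t : ℝ) (y : ℕ) :
    ‖smoothZetaC ((σ : ℂ) + t * I) y‖ ≤ smoothZeta σ y *
      Real.exp (-∑ p ∈ Nat.primesLE y, (p : ℝ) ^ (-σ) * (1 - Real.cos (t * Real.log p))) := by
  rw [smoothZetaC, smoothZeta, norm_prod, ← Finset.sum_neg_distrib, Real.exp_sum, ← Finset.prod_mul_distrib]
  refine Finset.prod_le_prod (fun p _ => norm_nonneg _) fun p hp => ?_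
  rw [norm_inv]
  exact inv_norm_one_sub_cpow_le_exp_neg (Nat.mem_primesLE.1 hp).2.two_le hσ t

/-! ### Near the real axis: the factor `(1 + v_p)^{-1/2}` kept exactly -/

/-- **The Euler factor near the axis, exactly**: for a prime `p` with `|t| log p ≤ π` and `σ > 0`,
`‖1 - p^{-(σ+it)}‖⁻¹ ≤ (1 - p^{-σ})⁻¹ exp(-½ log(1 + v_p))`, `v_p = (4/π²) t² log² p · p^σ/(p^σ - 1)²`
(`‖1 - p^{-s}‖² = (1 - p^{-σ})²(1 + w_p)` with `w_p ≥ v_p` by `1 - cos θ ≥ (2/π²)θ²`).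
[cite: HildebrandTenenbaum1986, Lemma 8, proof of (3.15), (3.17)] -/
theorem inv_norm_one_sub_cpow_le_exp_log (hp : 2 ≤ p) (hσ : 0 < σ) (ht : |t| * Real.log p ≤ Real.pi) :
    ‖1 - (p : ℂ) ^ (-((σ : ℂ) + t * I))‖⁻¹ ≤ (1 - (p : ℝ) ^ (-σ))⁻¹ *
      Real.exp (-(1 / 2) * Real.log (1 + 4 / Real.pi ^ 2 * t ^ 2 *
        (Real.log p ^ 2 * ((p : ℝ) ^ σ / ((p : ℝ) ^ σ - 1) ^ 2)))) := by
  have hp0 : 0 < p := by omega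
  have hp1r : (1 : ℝ) < p := by exact_mod_cast lt_of_lt_of_le one_lt_two hp
  have hp0r : (0 : ℝ) < p := by linarith
  have hlogp0 : 0 ≤ Real.log p := Real.log_nonneg hp1r.le
  set a : ℝ := (p : ℝ) ^ (-σ) with ha
  set c : ℝ := 1 - Real.cos (t * Real.log p) with hc
  have hP1 : 1 < (p : ℝ) ^ σ := Real.one_lt_rpow hp1r hσ
  have hinv : a = ((p : ℝ) ^ σ)⁻¹ := by rw [ha]; exact Real.rpow_neg hp0r.le σ
  have ha0 : 0 < a := by rw [ha]; exact Real.rpow_pos_of_pos hp0r _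
  have ha1 : a < 1 := by rw [hinv]; exact inv_lt_one_of_one_lt₀ hP1
  have h1a : 0 < 1 - a := by linarith
  have hc0 : 0 ≤ c := by rw [hc]; linarith [Real.cos_le_one (t * Real.log p)]
  set w : ℝ := 2 * a * c / (1 - a) ^ 2 with hw
  set g : ℝ := Real.log p ^ 2 * ((p : ℝ) ^ σ / ((p : ℝ) ^ σ - 1) ^ 2) with hg
  set v : ℝ := 4 / Real.pi ^ 2 * t ^ 2 * g with hv
  have hratio : a / (1 - a) ^ 2 = (p : ℝ) ^ σ / ((p : ℝ) ^ σ - 1) ^ 2 := by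
    rw [hinv]
    have hP0 : (p : ℝ) ^ σ ≠ 0 := by positivity
    have hP1' : (p : ℝ) ^ σ - 1 ≠ 0 := by linarith
    field_simp
  have hden : 0 < (p : ℝ) ^ σ - 1 := by linarith
  have hg0 : 0 ≤ g := by rw [hg]; positivity
  have hv0 : 0 ≤ v := by rw [hv]; positivity
  have hφ : |t * Real.log p| ≤ Real.pi := by rwa [abs_mul, abs_of_nonneg hlogp0]
  have hcos := two_div_pi_sq_mul_sq_le_one_sub_cos hφ
  have hvw : v ≤ w := by
    rw [hv, hw, hg, ← hratio]
    calc 4 / Real.pi ^ 2 * t ^ 2 * (Real.log p ^ 2 * (a / (1 - a) ^ 2))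
        = (2 / Real.pi ^ 2 * (t * Real.log p) ^ 2) * (2 * a / (1 - a) ^ 2) := by ring
      _ ≤ c * (2 * a / (1 - a) ^ 2) := mul_le_mul_of_nonneg_right (by rw [hc]; exact hcos) (by positivity)
      _ = 2 * a * c / (1 - a) ^ 2 := by ring
  have hnorm_sq : ‖1 - (p : ℂ) ^ (-((σ : ℂ) + t * I))‖ ^ 2 = (1 - a) ^ 2 * (1 + w) := by
    rw [norm_sq_one_sub_cpow_eq_mul hp hσ t]
  have h1v : 0 < 1 + v := by linarith
  have hkey : (1 + w)⁻¹ ≤ Real.exp (2 * (-(1 / 2) * Real.log (1 + v))) := by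
    calc (1 + w)⁻¹ ≤ (1 + v)⁻¹ := inv_anti₀ h1v (by linarith)
      _ = Real.exp (2 * (-(1 / 2) * Real.log (1 + v))) := by
          rw [show 2 * (-(1 / 2) * Real.log (1 + v)) = -Real.log (1 + v) by ring, Real.exp_neg,
            Real.exp_log h1v]
  have hpos : 0 < ‖1 - (p : ℂ) ^ (-((σ : ℂ) + t * I))‖ := by
    have hsre : 0 < ((σ : ℂ) + t * I).re := by simp [hσ]
    exact norm_pos_iff.2 (one_sub_cpow_ne_zero hp hsre)
  have hgoal_sq : ‖1 - (p : ℂ) ^ (-((σ : ℂ) + t * I))‖⁻¹ ^ 2 ≤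
      ((1 - a)⁻¹ * Real.exp (-(1 / 2) * Real.log (1 + v))) ^ 2 := by
    have hw0 : 0 ≤ w := by rw [hw]; positivity
    calc ‖1 - (p : ℂ) ^ (-((σ : ℂ) + t * I))‖⁻¹ ^ 2 = ((1 - a) ^ 2)⁻¹ * (1 + w)⁻¹ := by
          rw [inv_pow, hnorm_sq, mul_inv]
      _ ≤ ((1 - a) ^ 2)⁻¹ * Real.exp (2 * (-(1 / 2) * Real.log (1 + v))) :=
          mul_le_mul_of_nonneg_left hkey (by positivity)
      _ = ((1 - a)⁻¹ * Real.exp (-(1 / 2) * Real.log (1 + v))) ^ 2 := by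
          rw [mul_pow, inv_pow, ← Real.exp_nat_mul]
          push_cast
          ring_nf
  exact (pow_le_pow_iff_left₀ (by positivity) (by positivity) two_ne_zero).1 hgoal_sq

/-- `|ζ(σ + it, y)| ≤ ζ(σ, y) exp(-½ Σ_{p ≤ y} log(1 + v_p))` for `|t| log y ≤ π`, `σ > 0`
(`v_p = (4/π²) t² log² p · p^σ/(p^σ-1)²`). [cite: HildebrandTenenbaum1986, Lemma 8 (i), proof of (3.15)] -/
theorem norm_smoothZetaC_le_mul_exp_neg_half_sum_log (hσ : 0 < σ) (ht : |t| * Real.log y ≤ Real.pi) :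
    ‖smoothZetaC ((σ : ℂ) + t * I) y‖ ≤ smoothZeta σ y *
      Real.exp (-(1 / 2) * ∑ p ∈ Nat.primesLE y, Real.log (1 + 4 / Real.pi ^ 2 * t ^ 2 *
        (Real.log p ^ 2 * ((p : ℝ) ^ σ / ((p : ℝ) ^ σ - 1) ^ 2)))) := by
  have hy : ∀ p ∈ Nat.primesLE y, |t| * Real.log p ≤ Real.pi := by
    intro p hp
    obtain ⟨hpy, hpp⟩ := Nat.mem_primesLE.1 hp
    have hp0 : (0 : ℝ) < p := by exact_mod_cast hpp.pos
    exact le_trans (mul_le_mul_of_nonneg_left (Real.log_le_log hp0 (by exact_mod_cast hpy)) (abs_nonneg t)) ht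
  rw [smoothZetaC, smoothZeta, norm_prod, Finset.mul_sum, Real.exp_sum, ← Finset.prod_mul_distrib]
  refine Finset.prod_le_prod (fun p _ => norm_nonneg _) fun p hp => ?_
  rw [norm_inv]
  exact inv_norm_one_sub_cpow_le_exp_log (Nat.mem_primesLE.1 hp).2.two_le hσ (hy p hp)

/-- **Concavity of `log(1 + v)`**: for `0 ≤ v ≤ M`, `0 < M`: `(v/M) log(1 + M) ≤ log(1 + v)` (the chord
from `0` to `M` lies below the graph). [folklore] -/
theorem mul_log_one_add_le_log_one_add {v M : ℝ} (hv0 : 0 ≤ v) (hvM : v ≤ M) (hM : 0 < M) :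
    v / M * Real.log (1 + M) ≤ Real.log (1 + v) := by
  have hconc := strictConcaveOn_log_Ioi.concaveOn
  set θ : ℝ := v / M with hθ
  have hθ0 : 0 ≤ θ := div_nonneg hv0 hM.le
  have hθ1 : θ ≤ 1 := by rw [hθ, div_le_one hM]; exact hvM
  have h := hconc.2 (show (1 : ℝ) ∈ Set.Ioi (0 : ℝ) by norm_num)
    (show (1 + M : ℝ) ∈ Set.Ioi (0 : ℝ) by show (0 : ℝ) < 1 + M; linarith)
    (show (0 : ℝ) ≤ 1 - θ by linarith) hθ0 (show (1 - θ) + θ = 1 by ring)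
  simp only [smul_eq_mul, Real.log_one, mul_zero, zero_add, mul_one] at h
  have hcomb : (1 - θ) + θ * (1 + M) = 1 + v := by
    rw [hθ]; field_simp; ring
  rw [hcomb] at h
  rw [hθ] at h ⊢
  exact h

/-- **Lemma 8 (i) in the Gaussian–polynomial form.** Let `σ > 0`, `|t| log y ≤ π`, `K > 0`, and suppose
every weight is small against the total: `g_p = log² p · p^σ/(p^σ - 1)² ≤ φ₂(σ, y)/K` for all `p ≤ y`. Then
`|ζ(σ + it, y)| ≤ ζ(σ, y) · (1 + 4t²φ₂(σ, y)/(π²K))^{-K/2}` (`Σ log(1 + v_p) ≥ K log(1 + Σ v_p/K)` by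
`mul_log_one_add_le_log_one_add`, `Σ v_p = (4/π²)t²φ₂`). [cite: HildebrandTenenbaum1986, Lemma 8 (i) (3.15)] -/
theorem norm_smoothZetaC_le_mul_rpow_of_weight_le (hσ : 0 < σ) (ht : |t| * Real.log y ≤ Real.pi) {K : ℝ}
    (hK : 0 < K)
    (hg : ∀ p ∈ Nat.primesLE y,
      Real.log p ^ 2 * ((p : ℝ) ^ σ / ((p : ℝ) ^ σ - 1) ^ 2) ≤ saddlePhi₂ σ y / K) :
    ‖smoothZetaC ((σ : ℂ) + t * I) y‖ ≤ smoothZeta σ y *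
      (1 + 4 * t ^ 2 * saddlePhi₂ σ y / (Real.pi ^ 2 * K)) ^ (-(K / 2)) := by
  refine le_trans (norm_smoothZetaC_le_mul_exp_neg_half_sum_log hσ ht) ?_
  refine mul_le_mul_of_nonneg_left ?_ (smoothZeta_pos hσ).le
  have hπ : 0 < Real.pi := Real.pi_pos
  have hφ0 : 0 ≤ saddlePhi₂ σ y := saddlePhi₂_nonneg σ y
  set M : ℝ := 4 / Real.pi ^ 2 * t ^ 2 * saddlePhi₂ σ y / K with hMdef
  have hM0 : 0 ≤ M := by rw [hMdef]; positivity
  have hMeq : 1 + 4 * t ^ 2 * saddlePhi₂ σ y / (Real.pi ^ 2 * K) = 1 + M := by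
    rw [hMdef]; field_simp
  rw [hMeq]
  have h1M : 0 < 1 + M := by linarith
  rw [Real.rpow_def_of_pos h1M]
  refine Real.exp_le_exp.2 ?_
  -- `K log(1 + M) ≤ Σ log(1 + v_p)`
  suffices hsum : K * Real.log (1 + M) ≤ ∑ p ∈ Nat.primesLE y, Real.log (1 + 4 / Real.pi ^ 2 * t ^ 2 *
      (Real.log p ^ 2 * ((p : ℝ) ^ σ / ((p : ℝ) ^ σ - 1) ^ 2))) by
    nlinarith
  rcases eq_or_lt_of_le hM0 with hMz | hMpos
  · -- `M = 0`: the left side vanishes, the right side is a sum of `log(1 + v_p) ≥ 0`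
    rw [← hMz, add_zero, Real.log_one, mul_zero]
    refine Finset.sum_nonneg fun p hp => Real.log_nonneg ?_
    have := phi₂Weight_nonneg hp hσ
    have : 0 ≤ 4 / Real.pi ^ 2 * t ^ 2 * (Real.log p ^ 2 * ((p : ℝ) ^ σ / ((p : ℝ) ^ σ - 1) ^ 2)) := by
      positivity
    linarith
  · have hterm : ∀ p ∈ Nat.primesLE y,
        (4 / Real.pi ^ 2 * t ^ 2 * (Real.log p ^ 2 * ((p : ℝ) ^ σ / ((p : ℝ) ^ σ - 1) ^ 2))) / M *
          Real.log (1 + M) ≤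
        Real.log (1 + 4 / Real.pi ^ 2 * t ^ 2 *
          (Real.log p ^ 2 * ((p : ℝ) ^ σ / ((p : ℝ) ^ σ - 1) ^ 2))) := by
      intro p hp
      refine mul_log_one_add_le_log_one_add (by have := phi₂Weight_nonneg hp hσ; positivity) ?_ hMpos
      rw [hMdef]
      calc 4 / Real.pi ^ 2 * t ^ 2 * (Real.log p ^ 2 * ((p : ℝ) ^ σ / ((p : ℝ) ^ σ - 1) ^ 2))
          ≤ 4 / Real.pi ^ 2 * t ^ 2 * (saddlePhi₂ σ y / K) :=
            mul_le_mul_of_nonneg_left (hg p hp) (by positivity)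
        _ = 4 / Real.pi ^ 2 * t ^ 2 * saddlePhi₂ σ y / K := by ring
    have hsum_v : ∑ p ∈ Nat.primesLE y,
        (4 / Real.pi ^ 2 * t ^ 2 * (Real.log p ^ 2 * ((p : ℝ) ^ σ / ((p : ℝ) ^ σ - 1) ^ 2))) / M *
          Real.log (1 + M) = K * Real.log (1 + M) := by
      rw [← Finset.sum_mul, ← Finset.sum_div, ← Finset.mul_sum, ← saddlePhi₂_def]
      have hMK : 4 / Real.pi ^ 2 * t ^ 2 * saddlePhi₂ σ y = M * K := by
        rw [hMdef]; field_simp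
      rw [hMK, mul_div_cancel_left₀ _ hMpos.ne']
    calc K * Real.log (1 + M) = _ := hsum_v.symm
      _ ≤ _ := Finset.sum_le_sum hterm

/-! ### The two regimes at a general `σ > 0` -/

/-- **Regime `σ log y ≤ 1`** (e.g. the saddle point with `y ≤ log x`): every weight is `≤ 3/σ²` and
`φ₂(σ, y) ≥ π(y)/(9σ²)` (`phi₂Weight_bounds_of_mul_log_le_one`), so `K = π(y)/27` is admissible:
`|ζ(σ + it, y)| ≤ ζ(σ, y) (1 + 108 t² φ₂(σ, y)/(π² π(y)))^{-π(y)/54}` for `|t| log y ≤ π`, `y ≥ 2`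
(`π(y) = #{p ≤ y}`). [cite: HildebrandTenenbaum1986, Lemma 8 (i) (3.15), case y ≤ log x] -/
theorem norm_smoothZetaC_le_mul_rpow_of_mul_log_le_one (hσ : 0 < σ) (hy : 2 ≤ y)
    (hA : σ * Real.log y ≤ 1) (ht : |t| * Real.log y ≤ Real.pi) :
    ‖smoothZetaC ((σ : ℂ) + t * I) y‖ ≤ smoothZeta σ y *
      (1 + 108 * t ^ 2 * saddlePhi₂ σ y / (Real.pi ^ 2 * #(Nat.primesLE y))) ^
        (-((#(Nat.primesLE y) : ℝ) / 54)) := by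
  have h2 : 2 ∈ Nat.primesLE y := Nat.mem_primesLE.2 ⟨hy, Nat.prime_two⟩
  have hcard0 : 0 < (#(Nat.primesLE y) : ℝ) := by
    exact_mod_cast Finset.card_pos.2 ⟨2, h2⟩
  set K : ℝ := (#(Nat.primesLE y) : ℝ) / 27 with hK
  have hK0 : 0 < K := by positivity
  -- `φ₂ ≥ π(y)/(9σ²)`
  have hφlow : (#(Nat.primesLE y) : ℝ) * (1 / (9 * σ ^ 2)) ≤ saddlePhi₂ σ y := by
    rw [saddlePhi₂_def, ← nsmul_eq_mul, ← Finset.sum_const]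
    exact Finset.sum_le_sum fun p hp => (phi₂Weight_bounds_of_mul_log_le_one hp hσ hA).1
  have hg : ∀ p ∈ Nat.primesLE y,
      Real.log p ^ 2 * ((p : ℝ) ^ σ / ((p : ℝ) ^ σ - 1) ^ 2) ≤ saddlePhi₂ σ y / K := by
    intro p hp
    refine le_trans (phi₂Weight_bounds_of_mul_log_le_one hp hσ hA).2 ?_
    rw [hK, le_div_iff₀ hK0]
    calc 3 / σ ^ 2 * ((#(Nat.primesLE y) : ℝ) / 27) = (#(Nat.primesLE y) : ℝ) * (1 / (9 * σ ^ 2)) := by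
          field_simp; ring
      _ ≤ saddlePhi₂ σ y := hφlow
  have h := norm_smoothZetaC_le_mul_rpow_of_weight_le hσ ht hK0 hg
  have heq1 : 1 + 4 * t ^ 2 * saddlePhi₂ σ y / (Real.pi ^ 2 * K) =
      1 + 108 * t ^ 2 * saddlePhi₂ σ y / (Real.pi ^ 2 * #(Nat.primesLE y)) := by
    rw [hK]; field_simp; ring
  have heq2 : -(K / 2) = -((#(Nat.primesLE y) : ℝ) / 54) := by rw [hK]; ring
  rwa [heq1, heq2] at h

/-- **Regime `σ log y ≥ 1`: every weight is `≤ 20 log² y`** (`p ≤ y`): if `p^σ ≥ 5/4` then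
`g_p ≤ 20 log² p` (`phi₂Weight_le_of_le_rpow`), else `g_p ≤ (5/4)/σ² ≤ (5/4) log² y`
(`phi₂Weight_le_of_rpow_lt`, `1/σ ≤ log y`). [folklore] -/
theorem phi₂Weight_le_twenty_mul_log_sq (hp : p ∈ Nat.primesLE y) (hσ : 0 < σ)
    (hA : 1 ≤ σ * Real.log y) :
    Real.log p ^ 2 * ((p : ℝ) ^ σ / ((p : ℝ) ^ σ - 1) ^ 2) ≤ 20 * Real.log y ^ 2 := by
  obtain ⟨hpy, hpp⟩ := Nat.mem_primesLE.1 hp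
  have hp2 : (2 : ℝ) ≤ p := by exact_mod_cast hpp.two_le
  have hp0 : (0 : ℝ) < p := by linarith
  have hlogp : 0 < Real.log p := Real.log_pos (by linarith)
  have hlogpy : Real.log p ≤ Real.log y := Real.log_le_log hp0 (by exact_mod_cast hpy)
  by_cases hP : (5 : ℝ) / 4 ≤ (p : ℝ) ^ σ
  · calc _ ≤ 20 * Real.log p ^ 2 := phi₂Weight_le_of_le_rpow hp hP
      _ ≤ 20 * Real.log y ^ 2 := by gcongr
  · push Not at hP
    have h1σ : 1 / σ ≤ Real.log y := by rw [div_le_iff₀ hσ]; linarith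
    calc _ ≤ 5 / 4 * (1 / σ) ^ 2 := phi₂Weight_le_of_rpow_lt hp hσ hP
      _ ≤ 5 / 4 * Real.log y ^ 2 := by gcongr
      _ ≤ 20 * Real.log y ^ 2 := by nlinarith [sq_nonneg (Real.log y)]

/-- **Regime `σ log y ≥ 1`** (e.g. the saddle point with `y > log x`): `K = φ₂(σ, y)/(20 log² y)` is
admissible (`phi₂Weight_le_twenty_mul_log_sq`), whence for `|t| log y ≤ π`, `y ≥ 2`:
`|ζ(σ + it, y)| ≤ ζ(σ, y) (1 + 80 t² log² y/π²)^{-φ₂(σ, y)/(40 log² y)}` — since `t² log² y ≤ π²` the base is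
at most `81`, so this is a Gaussian `exp(-c t² φ₂(σ, y))` (next theorem); the point is that it holds with
NO lower-order additive term and for every `σ` with `σ log y ≥ 1`.
[cite: HildebrandTenenbaum1986, Lemma 8 (i) (3.15), case y > log x] -/
theorem norm_smoothZetaC_le_mul_rpow_of_one_le_mul_log (hσ : 0 < σ) (hy : 2 ≤ y)
    (hA : 1 ≤ σ * Real.log y) (ht : |t| * Real.log y ≤ Real.pi) :
    ‖smoothZetaC ((σ : ℂ) + t * I) y‖ ≤ smoothZeta σ y *
      (1 + 80 * t ^ 2 * Real.log y ^ 2 / Real.pi ^ 2) ^ (-(saddlePhi₂ σ y / (40 * Real.log y ^ 2))) := by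
  have hy1 : (1 : ℝ) < y := by exact_mod_cast lt_of_lt_of_le one_lt_two hy
  have hlogy : 0 < Real.log y := Real.log_pos hy1
  have hφ0 : 0 < saddlePhi₂ σ y := saddlePhi₂_pos hy hσ
  set K : ℝ := saddlePhi₂ σ y / (20 * Real.log y ^ 2) with hK
  have hK0 : 0 < K := by positivity
  have hg : ∀ p ∈ Nat.primesLE y,
      Real.log p ^ 2 * ((p : ℝ) ^ σ / ((p : ℝ) ^ σ - 1) ^ 2) ≤ saddlePhi₂ σ y / K := by
    intro p hp
    refine le_trans (phi₂Weight_le_twenty_mul_log_sq hp hσ hA) (le_of_eq ?_)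
    rw [hK]; field_simp
  have h := norm_smoothZetaC_le_mul_rpow_of_weight_le hσ ht hK0 hg
  have heq1 : 1 + 4 * t ^ 2 * saddlePhi₂ σ y / (Real.pi ^ 2 * K) =
      1 + 80 * t ^ 2 * Real.log y ^ 2 / Real.pi ^ 2 := by
    rw [hK]; field_simp; ring
  have heq2 : -(K / 2) = -(saddlePhi₂ σ y / (40 * Real.log y ^ 2)) := by rw [hK]; ring
  rwa [heq1, heq2] at h

/-- `log 81 ≥ 4.158` (`81 ≥ 64 = 2⁶`, `log 2 > 0.6931`). [folklore] -/
theorem log_eightyone_ge : (4.158 : ℝ) ≤ Real.log 81 := by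
  have h64 : Real.log 64 ≤ Real.log 81 := Real.log_le_log (by norm_num) (by norm_num)
  have h2 : Real.log 64 = 6 * Real.log 2 := by
    rw [show (64 : ℝ) = 2 ^ 6 by norm_num, Real.log_pow]; push_cast; ring
  have := Real.log_two_gt_d9
  linarith

/-- The Gaussian form of `norm_smoothZetaC_le_mul_rpow_of_one_le_mul_log`: for `σ log y ≥ 1`, `|t| log y ≤ π`,
`y ≥ 2`: `|ζ(σ + it, y)| ≤ ζ(σ, y) exp(-t² φ₂(σ, y)/100)` (`log(1 + 80 s/π²) ≥ (s/π²) log 81` for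
`0 ≤ s = t² log² y ≤ π²` by concavity, and `log 81/(40 π²) ≥ 1/100`). [cite: HildebrandTenenbaum1986, Lemma 8 (i) (3.15)] -/
theorem norm_smoothZetaC_le_mul_exp_neg_of_one_le_mul_log (hσ : 0 < σ) (hy : 2 ≤ y)
    (hA : 1 ≤ σ * Real.log y) (ht : |t| * Real.log y ≤ Real.pi) :
    ‖smoothZetaC ((σ : ℂ) + t * I) y‖ ≤ smoothZeta σ y * Real.exp (-(t ^ 2 * saddlePhi₂ σ y / 100)) := by
  refine le_trans (norm_smoothZetaC_le_mul_rpow_of_one_le_mul_log hσ hy hA ht) ?_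
  refine mul_le_mul_of_nonneg_left ?_ (smoothZeta_pos hσ).le
  have hy1 : (1 : ℝ) < y := by exact_mod_cast lt_of_lt_of_le one_lt_two hy
  have hlogy : 0 < Real.log y := Real.log_pos hy1
  have hφ0 : 0 ≤ saddlePhi₂ σ y := saddlePhi₂_nonneg σ y
  have hπ0 : 0 < Real.pi := Real.pi_pos
  set s : ℝ := t ^ 2 * Real.log y ^ 2 with hs
  have hsπ : s ≤ Real.pi ^ 2 := by
    have h := pow_le_pow_left₀ (by positivity) ht 2
    rw [mul_pow, sq_abs] at h
    exact h
  have hs0 : 0 ≤ s := by positivity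
  have hbase : 1 + 80 * t ^ 2 * Real.log y ^ 2 / Real.pi ^ 2 = 1 + 80 * s / Real.pi ^ 2 := by
    rw [hs]; ring
  rw [hbase]
  have h1 : 0 < 1 + 80 * s / Real.pi ^ 2 := by positivity
  rw [Real.rpow_def_of_pos h1]
  refine Real.exp_le_exp.2 ?_
  -- `log(1 + 80 s/π²) ≥ (s/π²) log 81`
  have hlog : s / Real.pi ^ 2 * Real.log 81 ≤ Real.log (1 + 80 * s / Real.pi ^ 2) := by
    have h := mul_log_one_add_le_log_one_add (v := 80 * s / Real.pi ^ 2) (M := 80) (by positivity)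
      (by rw [div_le_iff₀ (by positivity)]; nlinarith) (by norm_num)
    rw [show (1 : ℝ) + 80 = 81 by norm_num] at h
    calc s / Real.pi ^ 2 * Real.log 81 = 80 * s / Real.pi ^ 2 / 80 * Real.log 81 := by ring
      _ ≤ _ := h
  have hlog81 := log_eightyone_ge
  have hπ2 : Real.pi ^ 2 ≤ 9.93 := by
    have := Real.pi_lt_d2
    have := Real.pi_gt_three
    nlinarith
  have hmain : t ^ 2 * saddlePhi₂ σ y / 100 ≤ Real.log (1 + 80 * s / Real.pi ^ 2) *
      (saddlePhi₂ σ y / (40 * Real.log y ^ 2)) := by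
    calc t ^ 2 * saddlePhi₂ σ y / 100 = (s / Real.pi ^ 2) * (Real.pi ^ 2 * (2 / 5)) *
          (saddlePhi₂ σ y / (40 * Real.log y ^ 2)) := by
          rw [hs]; field_simp; ring
      _ ≤ (s / Real.pi ^ 2) * Real.log 81 * (saddlePhi₂ σ y / (40 * Real.log y ^ 2)) := by
          gcongr
          nlinarith
      _ ≤ _ := by gcongr
  linarith

/-! ### The majorant integrates to `≪ 1/√φ₂` -/

/-- **`∫_ℝ (1 + a t²)^{-K/2} dt ≤ π/√a`** for `a > 0`, `K ≥ 2` (`(1 + a t²)^{-K/2} ≤ (1 + a t²)⁻¹` and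
`∫ (1 + (√a t)²)⁻¹ = π/√a`). [folklore] -/
theorem integral_rpow_neg_le {a K : ℝ} (ha : 0 < a) (hK : 2 ≤ K) :
    ∫ t : ℝ, (1 + a * t ^ 2) ^ (-(K / 2)) ≤ Real.pi / Real.sqrt a := by
  have hsa : 0 < Real.sqrt a := Real.sqrt_pos.2 ha
  have hsa2 : Real.sqrt a ^ 2 = a := Real.sq_sqrt ha.le
  -- the comparison integral
  have hcomp : ∫ t : ℝ, (1 + (Real.sqrt a * t) ^ 2)⁻¹ = Real.pi / Real.sqrt a := by
    have h : ∫ x : ℝ, (1 + (Real.sqrt a * x) ^ 2)⁻¹ = |(Real.sqrt a)⁻¹| • ∫ u : ℝ, (1 + u ^ 2)⁻¹ :=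
      MeasureTheory.Measure.integral_comp_mul_left (fun u : ℝ => (1 + u ^ 2)⁻¹) (Real.sqrt a)
    rw [h, integral_univ_inv_one_add_sq, smul_eq_mul, abs_of_pos (inv_pos.2 hsa), inv_mul_eq_div]
  have hint : Integrable fun t : ℝ => (1 + (Real.sqrt a * t) ^ 2)⁻¹ := by
    have h := integrable_inv_one_add_sq.comp_mul_left' hsa.ne'
    simpa using h
  have hle : ∀ t : ℝ, (1 + a * t ^ 2) ^ (-(K / 2)) ≤ (1 + (Real.sqrt a * t) ^ 2)⁻¹ := by
    intro t
    have heq : 1 + (Real.sqrt a * t) ^ 2 = 1 + a * t ^ 2 := by rw [mul_pow, hsa2]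
    rw [heq]
    have h1 : 1 ≤ 1 + a * t ^ 2 := by nlinarith [sq_nonneg t]
    rw [← Real.rpow_neg_one]
    exact Real.rpow_le_rpow_of_exponent_le h1 (by linarith)
  have hnn : ∀ t : ℝ, 0 ≤ (1 + a * t ^ 2) ^ (-(K / 2)) := fun t =>
    Real.rpow_nonneg (by nlinarith [sq_nonneg t]) _
  calc ∫ t : ℝ, (1 + a * t ^ 2) ^ (-(K / 2)) ≤ ∫ t : ℝ, (1 + (Real.sqrt a * t) ^ 2)⁻¹ :=
        integral_mono_of_nonneg (Filter.Eventually.of_forall hnn) hint (Filter.Eventually.of_forall hle)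
    _ = Real.pi / Real.sqrt a := hcomp

end Literature.NumberTheory.Sieve
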